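import Summits.KontsevichZagierPeriods.Zeta5Search.Barrier.ConeGammaCuspGermChamber

/-!
# ζ(5) search — BARRIER: THE CUSP SLOPE IS INTEGER-LINEAR ON EVERY CLOSED FLIP-ORDER CHAMBER — `σ` is piecewise linear

HONEST FRAMING (cell `pub-zeta5`): systematic search; no irrationality claim unless kernel-certified. MODEL objects
under Brown–Zudilin's (28)+(30) accounting ([BZ22] = arXiv:2210.03391; (28) observed, not proved); nothing here is a
statement about `ζ(5)`, any `γ` of record, the cone's supremum (C2 OPEN) or the VALUE / SIGN of the cusp slope, of the
weights `𝒥` or of the chamber at a named direction (DATA of the cell); S-E stays CONJECTURED; records in print UNMOVED.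
Prover P2 g29, item «CONTINUITY AND PIECEWISE LINEARITY» (INBOX 2026-08-27), file (4); companion of
`ConeGammaCuspGermChamber` (the junction theorem) and `ConeGammaCuspSlopeLipschitz` (continuity).

`δ` is REFINED BY `δ₀` when `φ_k(δ)/h_k < φ_l(δ)/h_l ⇒ φ_k(δ₀)/h_k < φ_l(δ₀)/h_l` for all `k, l < 28` (every strict
flip-time inequality of `δ` is one of `δ₀`): the CLOSED FLIP-ORDER CHAMBER `C(δ₀)` — a convex cone (`refines_refl`,
`refines_add`, `refines_smul`) containing `δ₀` and stable under the orbit gauge `δ ↦ δ + c·s(a)` (`refines_add_smul_sParam`;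
`s(a)` itself lies in EVERY chamber, `refines_sParam`); the chambers `{C(δ)}_δ` cover `ℝ⁸`.
* **`cuspSlope_eq_intLinear_of_refines`** — for all 28 forms positive, `T > 0` a period and any `δ₀`: there is
  `𝒥 ∈ ℤ²⁸` with `Σ_k 𝒥_k = 0` such that `cuspSlope a T δ = Σ_k 𝒥_k · φ_k(δ)/h_k(a)` for EVERY `δ ∈ C(δ₀)` (sum of
  the junction theorems over one period at one admissible scale; `Σ 𝒥 = 0` because `σ(s(a)) = 0`, P2 g28's gauge);
* `cuspSlope_eq_intLinear_self`; **`cuspSlope_eq_intLinear_of_generic`** — on a TOP-dimensional chamber (the 28 flip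
  times of `δ₀` pairwise distinct) the weights are ORIENTED: `𝒥_k ≥ 0` on `F`, `𝒥_k ≤ 0` off `F`, `Σ 𝒥 = 0`;
* `phiForm_sum`, **`cuspSlope_add_of_refines`** (`σ(δ + δ′) = σ(δ) + σ(δ′)` inside one chamber),
  **`cuspSlope_sum_smul_of_refines`** (`σ(Σ t_i δ_i) = Σ t_i σ(δ_i)`, `t_i ≥ 0`, `δ_i ∈ C(δ₀)`),
  **`cuspSlope_nonpos_of_generators`** — THE FINITE TEST: `σ ≤ 0` at finitely many `δ_i ∈ C(δ₀)` gives `σ ≤ 0` on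
  their conic hull; `intLinear_nonpos_of_isLocalMax` — at a Regular open-box local maximiser of the MODEL `γ` (P2 g23)
  the chamber functional `Σ_k 𝒥_k φ_k/h_k` is `≤ 0` on the whole chamber.
With `continuous_cuspSlope`: `σ` is a continuous, degree-1 homogeneous, piecewise (integer-)linear function of the
displacement whose kinks lie on the member coincidences `φ_k/h_k = φ_l/h_l`.
DESK (DATA, `HOME/pub-zeta5-p2/g29/alg/facelin.py`, exact): `σ(δ) = Σ_k 𝒥_k φ_k(δ)/h_k` up to and on the first wall of
the chamber (27/27), `Σ 𝒥 = 0` (9/9), kink census: kinks only at coincidence walls. NOT here: anything about `γ` of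
record, C2, S-E, `ζ(5)`; the number of chambers; which chamber a named direction lies in.
-/

noncomputable section

open Set MeasureTheory
open scoped Topology

namespace Summit.KontsevichZagierPeriods.Zeta5Search.Barrier.ConeGamma

/-! ### The closed flip-order chamber is a convex cone containing the gauge line -/

/-- `δ₀` refines itself. -/
theorem refines_refl (a : Dir) (δ₀ : Fin 8 → ℝ) :
    ∀ k l : Fin 28, phiForm δ₀ k / h28 a k < phiForm δ₀ l / h28 a l →
      phiForm δ₀ k / h28 a k < phiForm δ₀ l / h28 a l := fun _ _ h => h

/-- The chamber is closed under addition. -/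
theorem refines_add {a : Dir} {δ₀ δ δ' : Fin 8 → ℝ}
    (h : ∀ k l : Fin 28, phiForm δ k / h28 a k < phiForm δ l / h28 a l →
      phiForm δ₀ k / h28 a k < phiForm δ₀ l / h28 a l)
    (h' : ∀ k l : Fin 28, phiForm δ' k / h28 a k < phiForm δ' l / h28 a l →
      phiForm δ₀ k / h28 a k < phiForm δ₀ l / h28 a l) :
    ∀ k l : Fin 28, phiForm (δ + δ') k / h28 a k < phiForm (δ + δ') l / h28 a l →
      phiForm δ₀ k / h28 a k < phiForm δ₀ l / h28 a l := by
  intro k l hlt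
  rw [phiForm_add, phiForm_add, add_div, add_div] at hlt
  by_contra hge
  have h1 : ¬ phiForm δ k / h28 a k < phiForm δ l / h28 a l := fun hh => hge (h k l hh)
  have h2 : ¬ phiForm δ' k / h28 a k < phiForm δ' l / h28 a l := fun hh => hge (h' k l hh)
  rw [not_lt] at h1 h2
  linarith

/-- The chamber is closed under non-negative scaling. -/
theorem refines_smul {a : Dir} {δ₀ δ : Fin 8 → ℝ} {t : ℝ} (ht : 0 ≤ t)
    (h : ∀ k l : Fin 28, phiForm δ k / h28 a k < phiForm δ l / h28 a l →
      phiForm δ₀ k / h28 a k < phiForm δ₀ l / h28 a l) :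
    ∀ k l : Fin 28, phiForm (t • δ) k / h28 a k < phiForm (t • δ) l / h28 a l →
      phiForm δ₀ k / h28 a k < phiForm δ₀ l / h28 a l := by
  intro k l hlt
  rw [phiForm_smul, phiForm_smul, mul_div_assoc, mul_div_assoc] at hlt
  rcases ht.eq_or_lt with rfl | ht'
  · simp at hlt
  · exact h k l (lt_of_mul_lt_mul_left hlt ht'.le)

/-- **The orbit direction lies in every chamber**: all 28 flip times of `c·s(a)` coincide (forms positive). -/
theorem refines_sParam {a : Dir} (hpos : ∀ k, 0 < h28 a k) (δ₀ : Fin 8 → ℝ) (c : ℝ) :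
    ∀ k l : Fin 28, phiForm (c • sParam a) k / h28 a k < phiForm (c • sParam a) l / h28 a l →
      phiForm δ₀ k / h28 a k < phiForm δ₀ l / h28 a l := by
  intro k l hlt
  rw [phiForm_smul_sParam, phiForm_smul_sParam, mul_div_cancel_right₀ _ (hpos k).ne',
    mul_div_cancel_right₀ _ (hpos l).ne'] at hlt
  exact absurd hlt (lt_irrefl _)

/-- The chamber is stable under the orbit gauge `δ ↦ δ + c·s(a)` (all flip times shift by the same amount). -/
theorem refines_add_smul_sParam {a : Dir} (hpos : ∀ k, 0 < h28 a k) {δ₀ δ : Fin 8 → ℝ} (c : ℝ)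
    (h : ∀ k l : Fin 28, phiForm δ k / h28 a k < phiForm δ l / h28 a l →
      phiForm δ₀ k / h28 a k < phiForm δ₀ l / h28 a l) :
    ∀ k l : Fin 28, phiForm (δ + c • sParam a) k / h28 a k < phiForm (δ + c • sParam a) l / h28 a l →
      phiForm δ₀ k / h28 a k < phiForm δ₀ l / h28 a l := by
  intro k l hlt
  rw [phiForm_add, phiForm_add, phiForm_smul_sParam, phiForm_smul_sParam, add_div, add_div,
    mul_div_cancel_right₀ _ (hpos k).ne', mul_div_cancel_right₀ _ (hpos l).ne'] at hlt
  exact h k l (by linarith)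

/-! ### The cusp slope on a chamber -/

/-- **THE CUSP SLOPE IS INTEGER-LINEAR ON EVERY CLOSED FLIP-ORDER CHAMBER.** For all 28 forms of `a` positive,
`T > 0` a period and any displacement `δ₀`: there are integers `𝒥_k` (`k < 28`) with `Σ_k 𝒥_k = 0` such that
`cuspSlope a T δ = Σ_k 𝒥_k · φ_k(δ)/h_k(a)` for EVERY `δ` refined by `δ₀`
(`φ_k(δ)/h_k < φ_l(δ)/h_l ⇒ φ_k(δ₀)/h_k < φ_l(δ₀)/h_l`). (`𝒥 = Σ` over the junctions of one period of the weights of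
`germ_pair_eq_intLinear_of_refines`; `Σ 𝒥 = 0` from `σ(s(a)) = 0`, `s(a)` lying in every chamber.) -/
theorem cuspSlope_eq_intLinear_of_refines {a : Dir} (hpos : ∀ k, 0 < h28 a k) {T : ℝ} (hT : 0 < T)
    (hper : ∀ k : Fin 28, ∃ z : ℤ, T * h28 a k = z) (δ₀ : Fin 8 → ℝ) :
    ∃ 𝒥 : Fin 28 → ℤ, ∑ k, 𝒥 k = 0 ∧
      ∀ δ : Fin 8 → ℝ, (∀ k l : Fin 28, phiForm δ k / h28 a k < phiForm δ l / h28 a l →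
          phiForm δ₀ k / h28 a k < phiForm δ₀ l / h28 a l) →
        cuspSlope a T δ = ∑ k, (𝒥 k : ℝ) * (phiForm δ k / h28 a k) := by
  classical
  -- the junction weights of one period
  have key : ∀ m : ℕ, ∃ J : Fin 28 → ℤ, m + 1 < (bkpts a T).card →
      ∀ δ : Fin 8 → ℝ, (∀ k l : Fin 28, phiForm δ k / h28 a k < phiForm δ l / h28 a l →
          phiForm δ₀ k / h28 a k < phiForm δ₀ l / h28 a l) →
        ∀ η, 0 < η → η * clusterBound a δ < 1 → η * clusterBound a δ < wallDist a T →
          germR a δ η (bkpt a T m) + germL a δ η (bkpt a T m) = ∑ k, (J k : ℝ) * (phiForm δ k / h28 a k) := by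
    intro m
    by_cases hm : m + 1 < (bkpts a T).card
    · obtain ⟨J, -, -, -, hJ⟩ :=
        germ_pair_eq_intLinear_of_refines hpos hT (bkpt_mem (by omega : m < (bkpts a T).card)) δ₀
      exact ⟨J, fun _ δ href η hη h1 h2 => hJ δ (fun k l _ _ h => href k l h) η hη h1 h2⟩
    · exact ⟨fun _ => 0, fun h => absurd h hm⟩
  choose J hJ using key
  have hlin : ∀ δ : Fin 8 → ℝ, (∀ k l : Fin 28, phiForm δ k / h28 a k < phiForm δ l / h28 a l →
      phiForm δ₀ k / h28 a k < phiForm δ₀ l / h28 a l) →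
      cuspSlope a T δ = ∑ k, ((∑ m ∈ Finset.range ((bkpts a T).card - 1), J m k : ℤ) : ℝ) *
        (phiForm δ k / h28 a k) := by
    intro δ href
    obtain ⟨ρ, hρ, h1, h2, hgap⟩ := exists_admissible_scale hpos hT δ
    rw [cuspSlope_eq_sum_germ_pairs hpos hT hper δ hρ h1 h2 hgap,
      Finset.sum_congr rfl fun m hm => hJ m (by have := Finset.mem_range.mp hm; omega) δ href ρ hρ h1 h2,
      Finset.sum_comm]
    refine Finset.sum_congr rfl fun k _ => ?_
    rw [Int.cast_sum, Finset.sum_mul]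
  refine ⟨fun k => ∑ m ∈ Finset.range ((bkpts a T).card - 1), J m k, ?_, hlin⟩
  -- `Σ 𝒥 = 0`: evaluate at `δ = s(a)`, which lies in every chamber and has `σ = 0`
  have h := hlin ((1 : ℝ) • sParam a) (refines_sParam hpos δ₀ 1)
  rw [cuspSlope_smul_sParam hpos hT hper 1] at h
  simp only [phiForm_smul_sParam, one_mul] at h
  rw [Finset.sum_congr rfl fun k _ => by rw [div_self (hpos k).ne', mul_one]] at h
  exact_mod_cast h.symm

/-- The instance `δ = δ₀`: `σ(δ₀) = Σ_k 𝒥_k · φ_k(δ₀)/h_k(a)` with `Σ 𝒥 = 0`. -/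
theorem cuspSlope_eq_intLinear_self {a : Dir} (hpos : ∀ k, 0 < h28 a k) {T : ℝ} (hT : 0 < T)
    (hper : ∀ k : Fin 28, ∃ z : ℤ, T * h28 a k = z) (δ₀ : Fin 8 → ℝ) :
    ∃ 𝒥 : Fin 28 → ℤ, ∑ k, 𝒥 k = 0 ∧ cuspSlope a T δ₀ = ∑ k, (𝒥 k : ℝ) * (phiForm δ₀ k / h28 a k) := by
  obtain ⟨𝒥, h0, hlin⟩ := cuspSlope_eq_intLinear_of_refines hpos hT hper δ₀
  exact ⟨𝒥, h0, hlin δ₀ (refines_refl a δ₀)⟩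

/-- **GENERIC CHAMBERS ARE ORIENTED.** If the 28 flip times of `δ₀` are pairwise distinct (a top-dimensional chamber),
the weights can be taken with `𝒥_k ≥ 0` for `k ∈ F` and `𝒥_k ≤ 0` for `k ∉ F` (every junction weight is a SIMPLE flip:
`0` or `+1` on `F`, `−1` or `0` off `F`, by wall orientation), still with `Σ_k 𝒥_k = 0` and
`σ(δ) = Σ_k 𝒥_k · φ_k(δ)/h_k(a)` on the whole closed chamber `C(δ₀)`. -/
theorem cuspSlope_eq_intLinear_of_generic {a : Dir} (hpos : ∀ k, 0 < h28 a k) {T : ℝ} (hT : 0 < T)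
    (hper : ∀ k : Fin 28, ∃ z : ℤ, T * h28 a k = z) {δ₀ : Fin 8 → ℝ}
    (hgen : ∀ k l : Fin 28, k ≠ l → phiForm δ₀ k / h28 a k ≠ phiForm δ₀ l / h28 a l) :
    ∃ 𝒥 : Fin 28 → ℤ, ∑ k, 𝒥 k = 0 ∧ (∀ k, k ∈ FIdx → 0 ≤ 𝒥 k) ∧ (∀ k, k ∉ FIdx → 𝒥 k ≤ 0) ∧
      ∀ δ : Fin 8 → ℝ, (∀ k l : Fin 28, phiForm δ k / h28 a k < phiForm δ l / h28 a l →
          phiForm δ₀ k / h28 a k < phiForm δ₀ l / h28 a l) →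
        cuspSlope a T δ = ∑ k, (𝒥 k : ℝ) * (phiForm δ k / h28 a k) := by
  classical
  -- singleton tie classes
  have hS : ∀ b (k l : Fin 28), (∃ z : ℤ, b * h28 a l = z) → phiForm δ₀ l / h28 a l = phiForm δ₀ k / h28 a k →
      l ∈ ({k} : Finset (Fin 28)) := fun b k l _ h => by
    rw [Finset.mem_singleton]
    by_contra hne
    exact hgen l k hne h
  have hF : ∀ k : Fin 28, k ∈ FIdx → (({k} : Finset (Fin 28)) ∩ FIdxᶜ) = ∅ := fun k hk =>
    Finset.eq_empty_of_forall_notMem fun l hl => by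
      rw [Finset.mem_inter, Finset.mem_singleton, Finset.mem_compl] at hl
      exact hl.2 (hl.1 ▸ hk)
  have hFc : ∀ k : Fin 28, k ∉ FIdx → (({k} : Finset (Fin 28)) ∩ FIdx) = ∅ := fun k hk =>
    Finset.eq_empty_of_forall_notMem fun l hl => by
      rw [Finset.mem_inter, Finset.mem_singleton] at hl
      exact hk (hl.1 ▸ hl.2)
  -- the junction weights of one period, with signs
  have key : ∀ m : ℕ, ∃ J : Fin 28 → ℤ, m + 1 < (bkpts a T).card →
      ((∀ k, k ∈ FIdx → 0 ≤ J k) ∧ (∀ k, k ∉ FIdx → J k ≤ 0)) ∧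
      ∀ δ : Fin 8 → ℝ, (∀ k l : Fin 28, phiForm δ k / h28 a k < phiForm δ l / h28 a l →
          phiForm δ₀ k / h28 a k < phiForm δ₀ l / h28 a l) →
        ∀ η, 0 < η → η * clusterBound a δ < 1 → η * clusterBound a δ < wallDist a T →
          germR a δ η (bkpt a T m) + germL a δ η (bkpt a T m) = ∑ k, (J k : ℝ) * (phiForm δ k / h28 a k) := by
    intro m
    by_cases hm : m + 1 < (bkpts a T).card
    · obtain ⟨J, -, -, hbd, hJ⟩ :=
        germ_pair_eq_intLinear_of_refines hpos hT (bkpt_mem (by omega : m < (bkpts a T).card)) δ₀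
      refine ⟨J, fun _ => ⟨⟨fun k hk => ?_, fun k hk => ?_⟩,
        fun δ href η hη h1 h2 => hJ δ (fun k l _ _ h => href k l h) η hη h1 h2⟩⟩
      · have h := (hbd k {k} (hS _ k)).1
        rw [hF k hk, Finset.card_empty] at h
        simpa using h
      · have h := (hbd k {k} (hS _ k)).2
        rw [hFc k hk, Finset.card_empty] at h
        simpa using h
    · exact ⟨fun _ => 0, fun h => absurd h hm⟩
  choose J hJ using key
  have hlin : ∀ δ : Fin 8 → ℝ, (∀ k l : Fin 28, phiForm δ k / h28 a k < phiForm δ l / h28 a l →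
      phiForm δ₀ k / h28 a k < phiForm δ₀ l / h28 a l) →
      cuspSlope a T δ = ∑ k, ((∑ m ∈ Finset.range ((bkpts a T).card - 1), J m k : ℤ) : ℝ) *
        (phiForm δ k / h28 a k) := by
    intro δ href
    obtain ⟨ρ, hρ, h1, h2, hgap⟩ := exists_admissible_scale hpos hT δ
    rw [cuspSlope_eq_sum_germ_pairs hpos hT hper δ hρ h1 h2 hgap,
      Finset.sum_congr rfl fun m hm => (hJ m (by have := Finset.mem_range.mp hm; omega)).2 δ href ρ hρ h1 h2,
      Finset.sum_comm]
    refine Finset.sum_congr rfl fun k _ => ?_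
    rw [Int.cast_sum, Finset.sum_mul]
  refine ⟨fun k => ∑ m ∈ Finset.range ((bkpts a T).card - 1), J m k, ?_, fun k hk => ?_, fun k hk => ?_, hlin⟩
  · have h := hlin ((1 : ℝ) • sParam a) (refines_sParam hpos δ₀ 1)
    rw [cuspSlope_smul_sParam hpos hT hper 1] at h
    simp only [phiForm_smul_sParam, one_mul] at h
    rw [Finset.sum_congr rfl fun k _ => by rw [div_self (hpos k).ne', mul_one]] at h
    exact_mod_cast h.symm
  · exact Finset.sum_nonneg fun m hm => (hJ m (by have := Finset.mem_range.mp hm; omega)).1.1 k hk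
  · exact Finset.sum_nonpos fun m hm => (hJ m (by have := Finset.mem_range.mp hm; omega)).1.2 k hk

/-! ### Consequences: additivity inside a chamber and the finite test -/

/-- The 28 forms are additive over finite sums. -/
theorem phiForm_sum {ι : Type*} (s : Finset ι) (f : ι → Fin 8 → ℝ) (k : Fin 28) :
    phiForm (∑ i ∈ s, f i) k = ∑ i ∈ s, phiForm (f i) k := by
  classical
  induction s using Finset.induction_on with
  | empty => simpa using phiForm_smul 0 (0 : Fin 8 → ℝ) k
  | insert i s hi ih => rw [Finset.sum_insert hi, Finset.sum_insert hi, phiForm_add, ih]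

/-- **ADDITIVITY INSIDE A CHAMBER**: for `δ, δ′ ∈ C(δ₀)`, `σ(δ + δ′) = σ(δ) + σ(δ′)`. -/
theorem cuspSlope_add_of_refines {a : Dir} (hpos : ∀ k, 0 < h28 a k) {T : ℝ} (hT : 0 < T)
    (hper : ∀ k : Fin 28, ∃ z : ℤ, T * h28 a k = z) {δ₀ δ δ' : Fin 8 → ℝ}
    (h : ∀ k l : Fin 28, phiForm δ k / h28 a k < phiForm δ l / h28 a l →
      phiForm δ₀ k / h28 a k < phiForm δ₀ l / h28 a l)
    (h' : ∀ k l : Fin 28, phiForm δ' k / h28 a k < phiForm δ' l / h28 a l →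
      phiForm δ₀ k / h28 a k < phiForm δ₀ l / h28 a l) :
    cuspSlope a T (δ + δ') = cuspSlope a T δ + cuspSlope a T δ' := by
  obtain ⟨𝒥, -, hlin⟩ := cuspSlope_eq_intLinear_of_refines hpos hT hper δ₀
  rw [hlin δ h, hlin δ' h', hlin (δ + δ') (refines_add h h'), ← Finset.sum_add_distrib]
  refine Finset.sum_congr rfl fun k _ => ?_
  rw [phiForm_add]
  ring

/-- A non-negative combination of elements of a chamber lies in the chamber. -/
theorem refines_sum_smul {a : Dir} {δ₀ : Fin 8 → ℝ} {ι : Type*} (s : Finset ι) {t : ι → ℝ}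
    {d : ι → Fin 8 → ℝ} (ht : ∀ i ∈ s, 0 ≤ t i)
    (h : ∀ i ∈ s, ∀ k l : Fin 28, phiForm (d i) k / h28 a k < phiForm (d i) l / h28 a l →
      phiForm δ₀ k / h28 a k < phiForm δ₀ l / h28 a l) :
    ∀ k l : Fin 28, phiForm (∑ i ∈ s, t i • d i) k / h28 a k < phiForm (∑ i ∈ s, t i • d i) l / h28 a l →
      phiForm δ₀ k / h28 a k < phiForm δ₀ l / h28 a l := by
  classical
  induction s using Finset.induction_on with
  | empty =>
    intro k l hlt
    simp only [Finset.sum_empty] at hlt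
    have h0 : phiForm (0 : Fin 8 → ℝ) k = 0 := by simpa using phiForm_smul 0 (0 : Fin 8 → ℝ) k
    have h0' : phiForm (0 : Fin 8 → ℝ) l = 0 := by simpa using phiForm_smul 0 (0 : Fin 8 → ℝ) l
    rw [h0, h0', zero_div, zero_div] at hlt
    exact absurd hlt (lt_irrefl _)
  | insert i s hi ih =>
    rw [Finset.sum_insert hi]
    exact refines_add (refines_smul (ht i (Finset.mem_insert_self _ _)) (h i (Finset.mem_insert_self _ _)))
      (ih (fun j hj => ht j (Finset.mem_insert_of_mem hj)) fun j hj => h j (Finset.mem_insert_of_mem hj))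

/-- **LINEARITY ON THE CONIC HULL**: for `δ_i ∈ C(δ₀)` and `t_i ≥ 0`, `σ(Σ_i t_i δ_i) = Σ_i t_i σ(δ_i)`. -/
theorem cuspSlope_sum_smul_of_refines {a : Dir} (hpos : ∀ k, 0 < h28 a k) {T : ℝ} (hT : 0 < T)
    (hper : ∀ k : Fin 28, ∃ z : ℤ, T * h28 a k = z) {δ₀ : Fin 8 → ℝ} {ι : Type*} (s : Finset ι) {t : ι → ℝ}
    {d : ι → Fin 8 → ℝ} (ht : ∀ i ∈ s, 0 ≤ t i)
    (h : ∀ i ∈ s, ∀ k l : Fin 28, phiForm (d i) k / h28 a k < phiForm (d i) l / h28 a l →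
      phiForm δ₀ k / h28 a k < phiForm δ₀ l / h28 a l) :
    cuspSlope a T (∑ i ∈ s, t i • d i) = ∑ i ∈ s, t i * cuspSlope a T (d i) := by
  obtain ⟨𝒥, -, hlin⟩ := cuspSlope_eq_intLinear_of_refines hpos hT hper δ₀
  rw [hlin _ (refines_sum_smul s ht h)]
  have hrhs : ∑ i ∈ s, t i * cuspSlope a T (d i) =
      ∑ i ∈ s, t i * ∑ k, (𝒥 k : ℝ) * (phiForm (d i) k / h28 a k) :=
    Finset.sum_congr rfl fun i hi => by rw [hlin (d i) (h i hi)]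
  rw [hrhs]
  simp_rw [phiForm_sum, phiForm_smul, Finset.sum_div, Finset.mul_sum]
  rw [Finset.sum_comm]
  refine Finset.sum_congr rfl fun i _ => Finset.sum_congr rfl fun k _ => ?_
  ring

/-- **THE FINITE TEST.** If `δ_1, …, δ_N` lie in the chamber `C(δ₀)` and `σ(δ_i) ≤ 0` for each `i`, then `σ ≤ 0` on their
conic hull: `σ(Σ_i t_i δ_i) ≤ 0` for all `t_i ≥ 0` — the necessary condition «`σ ≤ 0` in every direction» at a local
maximiser of the MODEL `γ` (`cuspSlope_nonpos_of_isLocalMax`) is checked chamber by chamber on finitely many generators. -/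
theorem cuspSlope_nonpos_of_generators {a : Dir} (hpos : ∀ k, 0 < h28 a k) {T : ℝ} (hT : 0 < T)
    (hper : ∀ k : Fin 28, ∃ z : ℤ, T * h28 a k = z) {δ₀ : Fin 8 → ℝ} {ι : Type*} (s : Finset ι) {t : ι → ℝ}
    {d : ι → Fin 8 → ℝ} (ht : ∀ i ∈ s, 0 ≤ t i)
    (h : ∀ i ∈ s, ∀ k l : Fin 28, phiForm (d i) k / h28 a k < phiForm (d i) l / h28 a l →
      phiForm δ₀ k / h28 a k < phiForm δ₀ l / h28 a l)
    (hle : ∀ i ∈ s, cuspSlope a T (d i) ≤ 0) :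
    cuspSlope a T (∑ i ∈ s, t i • d i) ≤ 0 := by
  rw [cuspSlope_sum_smul_of_refines hpos hT hper s ht h]
  exact Finset.sum_nonpos fun i hi => mul_nonpos_iff.mpr (Or.inl ⟨ht i hi, hle i hi⟩)

/-- **AT A LOCAL MAXIMISER THE CHAMBER FUNCTIONAL IS NON-POSITIVE ON THE CHAMBER.** At a Regular OPEN-box direction with
a period `T` and `Q = C₁ + δ₂₈ − Φ > 0` which is a local maximiser of the MODEL `γ` (P2 g23's hypotheses), for every
`δ₀` there is `𝒥 ∈ ℤ²⁸` with `Σ 𝒥 = 0` and `Σ_k 𝒥_k·φ_k(δ)/h_k(a) ≤ 0` for EVERY `δ ∈ C(δ₀)` (and `= σ(δ)` there).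
A necessary condition, not a location; `𝒥` at any named direction is DATA. -/
theorem intLinear_nonpos_of_isLocalMax {a : Dir}
    (hopen : ∀ j : Fin 7, 0 < sParam a j.succ ∧ sParam a j.succ < sParam a 0)
    {T : ℝ} (hT : 0 < T) (hper : ∀ k : Fin 28, ∃ z : ℤ, T * h28 a k = z)
    (hQ : 0 < C1 a + delta28 a - phi30 a) (hreg : Regular a) (hmax : IsLocalMax gamma a) (δ₀ : Fin 8 → ℝ) :
    ∃ 𝒥 : Fin 28 → ℤ, ∑ k, 𝒥 k = 0 ∧
      ∀ δ : Fin 8 → ℝ, (∀ k l : Fin 28, phiForm δ k / h28 a k < phiForm δ l / h28 a l →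
          phiForm δ₀ k / h28 a k < phiForm δ₀ l / h28 a l) →
        cuspSlope a T δ = ∑ k, (𝒥 k : ℝ) * (phiForm δ k / h28 a k) ∧
          ∑ k, (𝒥 k : ℝ) * (phiForm δ k / h28 a k) ≤ 0 := by
  obtain ⟨𝒥, h0, hlin⟩ := cuspSlope_eq_intLinear_of_refines (h28_pos_of_openBox hopen) hT hper δ₀
  exact ⟨𝒥, h0, fun δ href => ⟨hlin δ href,
    (hlin δ href) ▸ cuspSlope_nonpos_of_isLocalMax hopen hT hper δ hQ hreg hmax⟩⟩

end Summit.KontsevichZagierPeriods.Zeta5Search.Barrier.ConeGamma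

end
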